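import Summits.FinalStateConjecture.FinalStateConjecture.Theorems.EIHFluxBalanceInertialRecessionRechartAssemblyCore
import Summits.FinalStateConjecture.FinalStateConjecture.Theorems.EIHFluxBalanceInertialRecessionRechartHoleCausal
import Summits.FinalStateConjecture.FinalStateConjecture.Theorems.EIHFluxBalanceInertialRecessionRechartHoles
import Summits.FinalStateConjecture.FinalStateConjecture.Theorems.EIHFluxBalanceInertialRecessionRechartTransfer
import Summits.FinalStateConjecture.FinalStateConjecture.Theorems.EIHFluxBalanceInertialRecessionRechartMesh
import Summits.FinalStateConjecture.FinalStateConjecture.Theorems.EIHFluxBalanceInertialRecessionFlatPackageProfile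

/-!
# Route EIHFluxBalance — `InertialRecession`, re-charting: the `a = 0` re-charted decomposition
# from the packages (instantiation of the transfer and of the assembly core)

Helper file for the crux `stmt-FinalStateConjecture-10166`
(`Summit.FinalStateConjecture.FinalStateConjecture.Theses.EIHFluxBalance.InertialRecession`),
stub `stub_rechart` (the transfer P2 of line `sublinear-is-free-clean-window-charges`).

`exists_finalStateDecomposition_spinZero_of_packages`: from the PACKAGE-LEVEL data of the crux
antecedent with all spins `0` (orthochronous painted frames of lab velocities `vⱼ`, `‖vⱼ‖ ≤ κ₀ < 1`,
smooth centres, lab `C²` deviation `→ 0`, eventual bounds on two derivatives, pairwise recession,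
per-hole kinematic limits `vᵢ → Vᵢ`, `ξ̇ᵢ → Vᵢ`, `ξᵢ⁽²⁾, ξᵢ⁽³⁾ → 0`, `vᵢ⁽¹…³⁾ → 0`, Cesàro
velocities), the lab chart's causal clauses (`O = J⁺(ιX) ∩ I⁻(Φ(E))`, `Φ(E) ⊆ O`, exhaustion
toward lab slabs) and the two CAUSAL HYPOTHESES of the re-charting — (Ofut) future-orientation of
the lab chart on the late guaranteed region and (Hov) near-horizon loitering for every hole — the
development carries a `C²` `FinalStateDecomposition` of `O′ = J⁺(ιX) ∩ I⁻(charted′)` with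
sub-extremal holes and `HasExhaustiveCharts`. Proof: hole packages with diagonal radii
(`…RechartHoles`), meshed radii (`…RechartMesh`), flat package (`…FlatPackageProfile`), HOVER per
hole (`…RechartHoleCausal`), the transfer (`…RechartTransfer`), pairwise disjointness, and the
assembly core (`…RechartAssemblyCore`). [folklore]
-/

noncomputable section

set_option linter.dupNamespace false

open scoped Topology ContDiff InnerProductSpace Manifold ENNReal BigOperators
open Filter Set Metric Topology Function TopologicalSpace Literature.Geometry.Lorentzian

namespace Summit.FinalStateConjecture.FinalStateConjecture.Theorems

/-! ### Two small lemmas -/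

/-- Restricting an open embedding of the late region `{x⁰ > τ₀}` of an open set `W ⊆ E4` to a
later late region `{x⁰ > τ₁}`, `τ₀ ≤ τ₁`. [folklore] -/
theorem isOpenEmbedding_restrict_late_mono {Y : Type*} [TopologicalSpace Y] {W : Opens E4}
    {g : W → Y} {τ₀ τ₁ : ℝ} (h : τ₀ ≤ τ₁)
    (hemb : IsOpenEmbedding (({x : W | τ₀ < x.1 0} : Set W).restrict g)) :
    IsOpenEmbedding (({x : W | τ₁ < x.1 0} : Set W).restrict g) := by
  have hc0 : Continuous fun y : E4 ↦ y 0 := PiLp.continuous_apply 2 _ 0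
  have hL0 : IsOpen ({x : W | τ₀ < x.1 0} : Set W) :=
    isOpen_lt continuous_const (hc0.comp continuous_subtype_val)
  have hL1 : IsOpen ({x : W | τ₁ < x.1 0} : Set W) :=
    isOpen_lt continuous_const (hc0.comp continuous_subtype_val)
  let j : ({x : W | τ₁ < x.1 0} : Set W) → ({x : W | τ₀ < x.1 0} : Set W) :=
    fun x ↦ ⟨x.1, h.trans_lt x.2⟩
  have hg0 : IsOpenEmbedding (fun x : ({x : W | τ₀ < x.1 0} : Set W) ↦ (x.1.1 : E4)) :=
    W.isOpen.isOpenEmbedding_subtypeVal.comp hL0.isOpenEmbedding_subtypeVal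
  have hg1 : IsOpenEmbedding (fun x : ({x : W | τ₁ < x.1 0} : Set W) ↦ (x.1.1 : E4)) :=
    W.isOpen.isOpenEmbedding_subtypeVal.comp hL1.isOpenEmbedding_subtypeVal
  have hj : IsOpenEmbedding j := IsOpenEmbedding.of_comp j hg0 hg1
  exact hemb.comp hj

/-- `γ(V) = 1` only for `V = 0`: `(γ V)⁻¹ = 1 → ‖V‖ = 0`. [folklore] -/
theorem norm_eq_zero_of_inv_gamma_eq_one {V : E3} (hV : ‖V‖ < 1) (h : (Lorentz.gamma V)⁻¹ = 1) :
    ‖V‖ = 0 := by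
  have hk := Lorentz.gamma_sq_mul hV
  have hγ : Lorentz.gamma V = 1 := by
    have := congrArg (·⁻¹) h; simpa using this
  rw [hγ] at hk
  have h2 : ‖V‖ ^ 2 = 0 := by linarith
  exact pow_eq_zero_iff two_ne_zero |>.mp h2

/-- Registered one-line form (stub `norm_eq_zero_of_inv_gamma_eq_one_rechart` of the crux item) of
`norm_eq_zero_of_inv_gamma_eq_one`. [folklore] -/
theorem norm_eq_zero_of_inv_gamma_eq_one_rechart : open Literature.Geometry.Lorentzian in ∀ {V : E3}, ‖V‖ < 1 → (Lorentz.gamma V)⁻¹ = 1 → ‖V‖ = 0 :=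
  fun hV h ↦ norm_eq_zero_of_inv_gamma_eq_one hV h

/-! ### The re-charted decomposition from the packages -/

section Assembly

variable {X : Type} [TopologicalSpace X] [ChartedSpace E3 X] [IsManifold (𝓡 3) ∞ X]
  [ConnectedSpace X] {D : InitialDataSet (𝓡 3) X}

-- long bookkeeping proof
set_option maxHeartbeats 1600000 in
/-- **The `a = 0` re-charted decomposition from the packages.** See the module docstring.
[folklore] -/
theorem exists_finalStateDecomposition_spinZero_of_packages (𝒟 : VacuumCauchyDevelopment D)
    {N : ℕ} (i₀ : Fin N) (M rin : Fin N → ℝ) (hM : ∀ i, 0 < M i)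
    (hrin : ∀ j, rin j < Kerr.rPlus (M j) 0) (Λ : Fin N → ℝ → lorentzGroup)
    (ξ v : Fin N → ℝ → E3)
    (hfut : ∀ j t, 0 < (((Λ j t : E4 ≃L[ℝ] E4) (E4.basisVector 0)) 0))
    (hvΛ : ∀ j t, E4.spatial ((Λ j t : E4 ≃L[ℝ] E4) (E4.basisVector 0)) =
      (((Λ j t : E4 ≃L[ℝ] E4) (E4.basisVector 0)) 0) • v j t)
    (U : Opens E4) (Φ : U → 𝒟.carrier) (hΦ : ContMDiff 𝓘(ℝ, E4) (𝓡 4) ∞ Φ)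
    (hdev : Tendsto (fun t ↦ 𝒟.toSpacetime.deviationCk ⟨U, fun x ↦ Minkowski.bilin +
      ∑ j, (boostedKerrBilin (Λ j (x 0)) (E4.ofTimeSpace (x 0) (ξ j (x 0))) (M j) 0 x -
        Minkowski.bilin), fun x ↦ x 0, E4.spatialNorm⟩ Φ 2 t) atTop (𝓝 0))
    {κ₀ : ℝ} (hκ₀ : κ₀ < 1) (hvs : ∀ j t, ‖v j t‖ ≤ κ₀)
    (hv : ∀ j, ContDiff ℝ ∞ (v j)) (hξ : ∀ j, ContDiff ℝ ∞ (ξ j)) {Γ T₀ : ℝ}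
    (hvb : ∀ j t, T₀ ≤ t → ∀ l, 1 ≤ l → l ≤ 2 → ‖iteratedDeriv l (v j) t‖ ≤ Γ)
    (hξb : ∀ j t, T₀ ≤ t → ∀ l, 1 ≤ l → l ≤ 2 → ‖iteratedDeriv l (ξ j) t‖ ≤ Γ)
    (hsep : ∀ i j, i ≠ j → Tendsto (fun t ↦ ‖ξ i t - ξ j t‖) atTop atTop)
    (V : Fin N → E3) (hV1 : ∀ i, ‖V i‖ < 1) (hvV : ∀ i, Tendsto (v i) atTop (𝓝 (V i)))
    (hξV : ∀ i, Tendsto (deriv (ξ i)) atTop (𝓝 (V i)))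
    (hξ0 : ∀ i l, 2 ≤ l → l ≤ 3 → Tendsto (fun t ↦ iteratedDeriv l (ξ i) t) atTop (𝓝 0))
    (hv0 : ∀ i l, 1 ≤ l → l ≤ 3 → Tendsto (fun t ↦ iteratedDeriv l (v i) t) atTop (𝓝 0))
    (hces : ∀ i, Tendsto (fun t : ℝ ↦ t⁻¹ • ξ i t) atTop (𝓝 (V i)))
    {τ₀ : ℝ}
    (hU : {x : E4 | τ₀ < x 0 ∧ ∀ j, rin j < Kerr.radius 0 (poincareInv (Λ j (x 0))
      (E4.ofTimeSpace (x 0) (ξ j (x 0))) x)} ⊆ (U : Set E4))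
    (hembΦ : IsOpenEmbedding (({x : U | τ₀ < x.1 0} : Set U).restrict Φ))
    (O : Set 𝒟.carrier)
    (hO : O = 𝒟.metric.causalFuture 𝒟.timeOrientation (range 𝒟.embed) ∩
      𝒟.metric.chronologicalPast 𝒟.timeOrientation (Φ '' {x : U | τ₀ < x.1 0 ∧ ∀ j,
        Kerr.rPlus (M j) 0 < Kerr.radius 0 (poincareInv (Λ j (x.1 0))
          (E4.ofTimeSpace (x.1 0) (ξ j (x.1 0))) x.1)}))
    (himO : Φ '' {x : U | τ₀ < x.1 0 ∧ ∀ j, Kerr.rPlus (M j) 0 < Kerr.radius 0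
      (poincareInv (Λ j (x.1 0)) (E4.ofTimeSpace (x.1 0) (ξ j (x.1 0))) x.1)} ⊆ O)
    (hexh : ∀ t₁ : ℝ, τ₀ < t₁ → O \ Φ '' {x : U | t₁ < x.1 0 ∧ ∀ j, Kerr.rPlus (M j) 0 <
      Kerr.radius 0 (poincareInv (Λ j (x.1 0)) (E4.ofTimeSpace (x.1 0) (ξ j (x.1 0))) x.1)} ⊆
      𝒟.metric.causalPast 𝒟.timeOrientation (Φ '' {x : U | x.1 0 = t₁ ∧ ∀ j, Kerr.rPlus (M j) 0 <
        Kerr.radius 0 (poincareInv (Λ j (x.1 0)) (E4.ofTimeSpace (x.1 0) (ξ j (x.1 0))) x.1)}))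
    -- (Ofut): the lab chart is future-oriented on the late guaranteed region
    {TO : ℝ}
    (hOfut : ∀ x : U, TO < x.1 0 → (∀ j, rin j < Kerr.radius 0 (poincareInv (Λ j (x.1 0))
      (E4.ofTimeSpace (x.1 0) (ξ j (x.1 0))) x.1)) → ∀ w : E4, 0 < w 0 →
      𝒟.metric.val (Φ x) (mfderiv 𝓘(ℝ, E4) (𝓡 4) Φ x w) (mfderiv 𝓘(ℝ, E4) (𝓡 4) Φ x w) < 0 →
        𝒟.timeOrientation.IsFutureDirected (mfderiv 𝓘(ℝ, E4) (𝓡 4) Φ x w))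
    -- (Hov): near-horizon loitering, for every hole
    (hHov : ∀ i : Fin N, ∃ δ K TH : ℝ, 0 < δ ∧ Kerr.rPlus (M i) 0 + δ < K ∧
      ∀ x : U, TH < x.1 0 → (∀ j, Kerr.rPlus (M j) 0 < Kerr.radius 0 (poincareInv (Λ j (x.1 0))
        (E4.ofTimeSpace (x.1 0) (ξ j (x.1 0))) x.1)) →
      Kerr.radius 0 (poincareInv (Λ i (x.1 0)) (E4.ofTimeSpace (x.1 0) (ξ i (x.1 0))) x.1) <
        Kerr.rPlus (M i) 0 + δ → ∀ s : ℝ, 0 < s →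
      ∃ (γ : ℝ → 𝒟.carrier) (b : ℝ), 0 < b ∧
        𝒟.metric.IsFutureCausalCurveOn 𝒟.timeOrientation γ (Icc 0 b) ∧ γ 0 = Φ x ∧
        γ b ∈ Φ '' {z : U | z.1 0 = x.1 0 + s ∧
          Kerr.rPlus (M i) 0 <
            Kerr.radius 0 (poincareInv (Λ i (z.1 0)) (E4.ofTimeSpace (z.1 0) (ξ i (z.1 0))) z.1) ∧
          Kerr.radius 0 (poincareInv (Λ i (z.1 0)) (E4.ofTimeSpace (z.1 0) (ξ i (z.1 0))) z.1) < K} ∧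
        ∀ σ ∈ Icc 0 b, γ σ ∈ Φ '' {z : U | x.1 0 ≤ z.1 0 ∧
          Kerr.rPlus (M i) 0 <
            Kerr.radius 0 (poincareInv (Λ i (z.1 0)) (E4.ofTimeSpace (z.1 0) (ξ i (z.1 0))) z.1) ∧
          Kerr.radius 0 (poincareInv (Λ i (z.1 0)) (E4.ofTimeSpace (z.1 0) (ξ i (z.1 0))) z.1) < K}) :
    ∃ (O' : Set 𝒟.carrier) (d : FinalStateDecomposition 𝒟.toSpacetime O' 2),
      (∀ i, Kerr.IsSubextremal (d.mass i) (d.spin i)) ∧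
        O' = Summit.FinalStateConjecture.exteriorOf 𝒟.toCauchyDevelopment d.charted ∧
          Summit.FinalStateConjecture.HasExhaustiveCharts d := by
  classical
  -- ### notation
  set rp : Fin N → U → ℝ := fun j x ↦ Kerr.radius 0 (poincareInv (Λ j (x.1 0))
    (E4.ofTimeSpace (x.1 0) (ξ j (x.1 0))) x.1) with hrp
  set Pext : U → Prop := fun x ↦ ∀ j, Kerr.rPlus (M j) 0 < rp j x with hPext
  set γ₀ : ℝ := (Real.sqrt (1 - κ₀ ^ 2))⁻¹ with hγ₀
  have hκ : 0 ≤ κ₀ := (norm_nonneg (v i₀ 0)).trans (hvs i₀ 0)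
  have hγ₀1 : 1 ≤ γ₀ := one_le_inv_sqrt_one_sub_sq hκ hκ₀
  have hv1 : ∀ j t, ‖v j t‖ < 1 := fun j t ↦ (hvs j t).trans_lt hκ₀
  have hrp0 : ∀ j, 0 < Kerr.rPlus (M j) 0 := fun j ↦ by rw [Kerr.rPlus_zero_right (hM j).le]; linarith [hM j]
  -- ### the hole packages, after `τ* = max τ₀ TO`
  set τs : ℝ := max τ₀ TO with hτs
  have hUs : {x : E4 | τs < x 0 ∧ ∀ j, rin j < Kerr.radius 0 (poincareInv (Λ j (x 0))
      (E4.ofTimeSpace (x 0) (ξ j (x 0))) x)} ⊆ (U : Set E4) := fun x hx ↦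
    hU ⟨(le_max_left _ _).trans_lt hx.1, hx.2⟩
  have hsep' : ∀ i, ∀ j ≠ i, Tendsto (fun t ↦ ‖ξ i t - ξ j t‖) atTop atTop :=
    fun i j hj ↦ hsep i j (Ne.symm hj)
  choose T ρ θ Rd A hAU hpk using fun i ↦ exists_holePackage_diag 𝒟.toSpacetime i M Λ ξ v hfut hvΛ U Φ hΦ hdev
    hκ₀ hvs hv hξ hvb hξb (hsep' i) (hM i) (hV1 i) (hvV i) (hξV i) (hξ0 i) (hv0 i) hrin hUs
  have hτT : ∀ i, τs ≤ T i := fun i ↦ (hpk i).1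
  have hA : ∀ i, ContDiff ℝ ∞ (A i) := fun i ↦ (hpk i).2.1
  have hAemb : ∀ i, IsOpenEmbedding (A i) := fun i ↦ (hpk i).2.2.1
  have hρc : ∀ i, Continuous (ρ i) := fun i ↦ (hpk i).2.2.2.1
  have hρt : ∀ i, Tendsto (ρ i) atTop atTop := fun i ↦ (hpk i).2.2.2.2.1
  have hAT : ∀ i (x : E4), T i < A i x 0 := fun i ↦ (hpk i).2.2.2.2.2.2.1
  have himg := fun i ↦ (hpk i).2.2.2.2.2.2.2.1
  have hhon := fun i ↦ (hpk i).2.2.2.2.2.2.2.2.1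
  have hcovA := fun i ↦ (hpk i).2.2.2.2.2.2.2.2.2.1
  have hrad2 := fun i ↦ (hpk i).2.2.2.2.2.2.2.2.2.2.1
  have hAθ : ∀ i (x : E4), A i x 0 = θ i (x 0) := fun i ↦ (hpk i).2.2.2.2.2.2.2.2.2.2.2.1
  have hθid : ∀ i s, T i + 1 ≤ s → θ i s = s := fun i ↦ (hpk i).2.2.2.2.2.2.2.2.2.2.2.2.1
  have hθ' : ∀ i s, 0 < deriv (θ i) s := fun i ↦ (hpk i).2.2.2.2.2.2.2.2.2.2.2.2.2.1
  have hDA : ∀ i (x w : E4), (fderiv ℝ (A i) x w) 0 = deriv (θ i) (x 0) * w 0 :=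
    fun i ↦ (hpk i).2.2.2.2.2.2.2.2.2.2.2.2.2.2.1
  have hconvR := fun i ↦ (hpk i).2.2.2.2.2.2.2.2.2.2.2.2.2.2.2.1
  have hRd0 : ∀ i t, 0 ≤ Rd i t := fun i ↦ (hpk i).2.2.2.2.2.2.2.2.2.2.2.2.2.2.2.2.1
  have hRdt : ∀ i, Tendsto (Rd i) atTop atTop := fun i ↦ (hpk i).2.2.2.2.2.2.2.2.2.2.2.2.2.2.2.2.2.1
  have hRdc := fun i ↦ (hpk i).2.2.2.2.2.2.2.2.2.2.2.2.2.2.2.2.2.2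
  have hτ0T : ∀ i, τ₀ ≤ T i := fun i ↦ (le_max_left _ _).trans (hτT i)
  have hTOT : ∀ i, TO ≤ T i := fun i ↦ (le_max_right _ _).trans (hτT i)
  -- painted radii at the lab points of the hole charts
  have hPextA : ∀ (i : Fin N)
      (y : (boostedKerrBackground (Lorentz.boost (V i) (hV1 i)) 0 (M i) 0).domain),
      Pext ⟨A i y.1, hAU i y.1 y.2⟩ := by
    intro i y
    have hy := y.2
    change y.1 ∈ boostedKerrExterior (Lorentz.boost (V i) (hV1 i)) 0 (M i) 0 at hy
    rw [mem_boostedKerrExterior, Kerr.mem_exterior, poincareInv_zero, Kerr.radius_zero_left,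
      max_eq_left (hrp0 i).le] at hy
    exact himg i y.1 hy
  have hQA : ∀ (i : Fin N)
      (y : (boostedKerrBackground (Lorentz.boost (V i) (hV1 i)) 0 (M i) 0).domain),
      TO < A i y.1 0 ∧ ∀ j, rin j < rp j ⟨A i y.1, hAU i y.1 y.2⟩ := fun i y ↦
    ⟨(hTOT i).trans_lt (hAT i y.1), fun j ↦ (hrin j).trans (hPextA i y j)⟩
  -- ### loitering data and meshed radii
  choose δ K TH hδ hδK hHov' using hHov
  have hγV : ∀ i, 0 < Lorentz.gamma (V i) := fun i ↦ Lorentz.gamma_pos (hV1 i)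
  obtain ⟨R, R', hRm, hRle, hRt, hR'c, hR'0, hR't, hR'd, Tm, hTm⟩ :=
    exists_meshed_radii i₀ Rd ρ hRd0 hRdt hρc hρt (C := γ₀ ^ 2) (by nlinarith)
      (fun i ↦ (Lorentz.gamma (V i))⁻¹) (fun i ↦ ‖V i‖) K (fun i ↦ inv_pos.mpr (hγV i))
      (fun i ↦ inv_le_one_of_one_le₀ (Lorentz.one_le_gamma (hV1 i)))
      (fun i h ↦ norm_eq_zero_of_inv_gamma_eq_one (hV1 i) h)
      (1 + ∑ i, |rin i| + ∑ i, Kerr.rPlus (M i) 0)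
  have hR'1 : ∀ t, 1 ≤ R' t := fun t ↦ by
    have h1 : 0 ≤ ∑ i, |rin i| := Finset.sum_nonneg fun i _ ↦ abs_nonneg _
    have h2 : 0 ≤ ∑ i, Kerr.rPlus (M i) 0 := Finset.sum_nonneg fun i _ ↦ (hrp0 i).le
    linarith [hR'0 t]
  have hR'rp : ∀ t j, Kerr.rPlus (M j) 0 < R' t := fun t j ↦ by
    have h1 : 0 ≤ ∑ i, |rin i| := Finset.sum_nonneg fun i _ ↦ abs_nonneg _
    have h2 : Kerr.rPlus (M j) 0 ≤ ∑ i, Kerr.rPlus (M i) 0 :=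
      Finset.single_le_sum (f := fun i ↦ Kerr.rPlus (M i) 0) (fun i _ ↦ (hrp0 i).le)
        (Finset.mem_univ j)
    linarith [hR'0 t]
  -- near-zone convergence along the meshed radii
  have hconvRi : ∀ i, Tendsto (fun τ ↦ 𝒟.toSpacetime.truncDeviationCk
      (boostedKerrBackground (Lorentz.boost (V i) (hV1 i)) 0 (M i) 0)
      (fun y ↦ Φ ⟨A i y.1, hAU i y.1 y.2⟩) 2 (R i τ) τ) atTop (𝓝 0) := fun i ↦
    tendsto_of_tendsto_of_tendsto_of_le_of_le tendsto_const_nhds (hRdc i) (fun _ ↦ zero_le)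
      fun τ ↦ 𝒟.toSpacetime.truncDeviationCk_mono _ _ 2 (hRle i τ) τ
  -- ### the flat package
  have hembs : IsOpenEmbedding (({x : U | τs < x.1 0} : Set U).restrict Φ) :=
    isOpenEmbedding_restrict_late_mono (le_max_left _ _) hembΦ
  obtain ⟨U₀, hU₀, ρexc, hU₀eq, hexc, htube, hflatdev, hflatemb⟩ :=
    flat_radiationZone_package_of_profile' 𝒟.toSpacetime M rin Λ ξ v τs U Φ hΦ hUs hembs (k := 2)
      hdev hfut hvΛ hκ₀ hvs hv hξ hvb hξb V hV1 hces hR'c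
      (fun t ↦ by
        have h2 : 0 ≤ ∑ i, Kerr.rPlus (M i) 0 := Finset.sum_nonneg fun i _ ↦ (hrp0 i).le
        linarith [hR'0 t]) hR't hR'd
  -- ### HOVER per hole
  have hhov : ∀ i, ∃ S τh : ℝ,
      ∀ (y : (boostedKerrBackground (Lorentz.boost (V i) (hV1 i)) 0 (M i) 0).domain) (τ₁ : ℝ),
      τh ≤ τ₁ → S ≤ (boostedKerrBackground (Lorentz.boost (V i) (hV1 i)) 0 (M i) 0).time y.1 →
      (boostedKerrBackground (Lorentz.boost (V i) (hV1 i)) 0 (M i) 0).time y.1 ≤ τ₁ →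
      (boostedKerrBackground (Lorentz.boost (V i) (hV1 i)) 0 (M i) 0).radius y.1 ≤
        R i ((boostedKerrBackground (Lorentz.boost (V i) (hV1 i)) 0 (M i) 0).time y.1) →
      Φ ⟨A i y.1, hAU i y.1 y.2⟩ ∈ 𝒟.metric.causalPast 𝒟.timeOrientation
        ((fun y : (boostedKerrBackground (Lorentz.boost (V i) (hV1 i)) 0 (M i) 0).domain ↦
          Φ ⟨A i y.1, hAU i y.1 y.2⟩) ''
          (boostedKerrBackground (Lorentz.boost (V i) (hV1 i)) 0 (M i) 0).truncTimeSlab (R i τ₁) τ₁) :=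
    fun i ↦ exists_hover_rechart U Φ hΦ (hM i) (hV1 i) (ξ i) (v i) (hv1 i) hκ₀ (hvs i) (Λ i) (hfut i)
      (hvΛ i) (hA i) (hAemb i) (hAU i) (hAT i) (hτ0T i) hembΦ (hcovA i) (hrad2 i) (hAθ i) (hθid i)
      (hθ' i) (hDA i) (hρt i)
      (fun x ↦ TO < x.1 0 ∧ ∀ j, rin j < rp j x) (fun x hQ w ↦ hOfut x hQ.1 hQ.2 w) (hQA i)
      (R i) (hRm i) (hRt i) (hconvRi i) Pext (hPextA i) (hδ i) (hδK i) (hHov' i)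
  choose S τh hhov using hhov
  -- ### thresholds
  set Tc : ℝ := 1 + ∑ i, |T i| + |Tm| with hTc
  set Sa : ℝ := ∑ i, |S i| with hSa
  set τ₁₀ : ℝ := |τs| + 2 + Tc + ∑ i, |τh i| + |Tm| + 2 * |Sa| * ∑ i, Lorentz.gamma (V i) + 1
    with hτ₁₀
  have hTcT : ∀ i, T i + 1 ≤ Tc := fun i ↦ by
    have : |T i| ≤ ∑ i, |T i| :=
      Finset.single_le_sum (f := fun i ↦ |T i|) (fun i _ ↦ abs_nonneg _) (Finset.mem_univ i)
    rw [hTc]; linarith [le_abs_self (T i), abs_nonneg Tm]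
  have hTcm : Tm ≤ Tc := by rw [hTc]; linarith [le_abs_self Tm, Finset.sum_nonneg (fun i _ ↦ abs_nonneg (T i)) (s := Finset.univ)]
  have hTc0 : 0 ≤ Tc := by rw [hTc]; linarith [abs_nonneg Tm, Finset.sum_nonneg (fun i _ ↦ abs_nonneg (T i)) (s := Finset.univ)]
  have hγsum : ∀ i, Lorentz.gamma (V i) ≤ ∑ i, Lorentz.gamma (V i) := fun i ↦
    Finset.single_le_sum (f := fun i ↦ Lorentz.gamma (V i)) (fun i _ ↦ (hγV i).le) (Finset.mem_univ i)
  have hτ₁₀ge : Tc ≤ τ₁₀ ∧ Tm ≤ τ₁₀ ∧ max τs 0 + 2 ≤ τ₁₀ ∧ (∀ i, τh i ≤ τ₁₀) ∧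
      ∀ i, 2 * |Sa| * Lorentz.gamma (V i) ≤ τ₁₀ := by
    have h1 : 0 ≤ ∑ i, |τh i| := Finset.sum_nonneg fun i _ ↦ abs_nonneg _
    have h2 : 0 ≤ ∑ i, Lorentz.gamma (V i) := Finset.sum_nonneg fun i _ ↦ (hγV i).le
    have h3 : 0 ≤ 2 * |Sa| * ∑ i, Lorentz.gamma (V i) := by positivity
    have h4 : max τs 0 ≤ |τs| := max_le (le_abs_self _) (abs_nonneg _)
    refine ⟨by rw [hτ₁₀]; linarith [abs_nonneg τs, abs_nonneg Tm], ?_, by rw [hτ₁₀]; linarith [abs_nonneg Tm],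
      fun i ↦ ?_, fun i ↦ ?_⟩
    · rw [hτ₁₀]; linarith [abs_nonneg τs, le_abs_self Tm]
    · have : |τh i| ≤ ∑ i, |τh i| :=
        Finset.single_le_sum (f := fun i ↦ |τh i|) (fun i _ ↦ abs_nonneg _) (Finset.mem_univ i)
      rw [hτ₁₀]; linarith [abs_nonneg τs, abs_nonneg Tm, le_abs_self (τh i)]
    · have : 2 * |Sa| * Lorentz.gamma (V i) ≤ 2 * |Sa| * ∑ i, Lorentz.gamma (V i) :=
        mul_le_mul_of_nonneg_left (hγsum i) (by positivity)
      rw [hτ₁₀]; linarith [abs_nonneg τs, abs_nonneg Tm]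
  obtain ⟨hτTc, hτTm, hτs2, hττh, hτS⟩ := hτ₁₀ge
  have hτ : τ₀ < τ₁₀ := by
    have : τ₀ ≤ max τs 0 := (le_max_left τ₀ TO).trans (le_max_left _ _)
    linarith
  have hSi : ∀ i, S i ≤ Sa := fun i ↦ (le_abs_self _).trans
    (Finset.single_le_sum (f := fun i ↦ |S i|) (fun i _ ↦ abs_nonneg _) (Finset.mem_univ i))
  -- ### painted radius ≤ γ₀ × lab distance at honest late lab points
  have hrpw : ∀ i (x : U), T i + 1 ≤ x.1 0 → γ₀ * ‖E4.spatial x.1 - ξ i (x.1 0)‖ ≤ ρ i (x.1 0) / 2 →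
      rp i x ≤ γ₀ * ‖E4.spatial x.1 - ξ i (x.1 0)‖ := by
    intro i x hx0 hxρ
    set t := x.1 0 with ht
    set w : E3 := E4.spatial x.1 - ξ i t with hw
    set P : E3 := w + (Lorentz.gamma (v i t) ^ 2 / (Lorentz.gamma (v i t) + 1) * inner ℝ (v i t) w) • v i t
      with hP
    have hPle : ‖P‖ ≤ γ₀ * ‖w‖ := (norm_restOffsetInv_le (hv1 i t) w).trans
      (mul_le_mul_of_nonneg_right (lorentzGamma_le_of_norm_le hκ₀ (hvs i t)) (norm_nonneg _))
    obtain ⟨x', hAx', hx'0, hsp, -⟩ := hcovA i x.1 hx0 (hPle.trans hxρ)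
    have hx't : A i x' 0 = t := by rw [hAx']
    obtain ⟨-, hup⟩ := hrad2 i x' (Λ i t) (hfut i t) (by rw [hx't]; exact hvΛ i t)
    rw [hsp, hAx'] at hup
    rw [← ht] at hup
    rw [← hw] at hup
    rw [← hP] at hup
    have hrp' : rp i x = E4.spatialNorm (((Λ i t : E4 ≃L[ℝ] E4)).symm (x.1 - E4.ofTimeSpace t (ξ i t))) := by
      show Kerr.radius 0 (poincareInv (Λ i t) (E4.ofTimeSpace t (ξ i t)) x.1) = _
      rw [radius_poincareInv_eq, Kerr.radius_zero_left, ContinuousLinearEquiv.coe_coe]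
    rw [hrp']
    exact hup.trans hPle
  -- ### the transfer
  have htransfer := fun τ₁ (hτ₁ : τ₁₀ ≤ τ₁) ↦ exterior_subset_certified_union_causalPast U Φ O Pext rp
    (fun j ↦ Kerr.rPlus (M j) 0)
    (fun i ↦ boostedKerrBackground (Lorentz.boost (V i) (hV1 i)) 0 (M i) 0)
    (fun i y ↦ Φ ⟨A i y.1, hAU i y.1 y.2⟩) R hRm U₀ hU₀ (fun t ↦ γ₀ * R' t)
    (fun i ↦ (Lorentz.gamma (V i))⁻¹) (fun i ↦ ‖V i‖) (τ₀ := τ₀) (τ₀' := τ₁₀) (Tc := Tc) (S := Sa)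
    hτ hτTc (fun i ↦ norm_nonneg _) hexh
    (by
      -- hsplit
      intro x hx hxP
      by_cases hxU : x.1 ∈ (U₀ : Set E4)
      · exact Or.inl hxU
      · right
        rw [hU₀eq] at hxU
        simp only [Set.mem_setOf_eq, not_and, not_forall, not_lt] at hxU
        obtain ⟨i, hi⟩ := hxU (by linarith [le_max_left τs 0, le_max_right τs 0])
        refine ⟨i, ?_⟩
        have hxT : T i + 1 ≤ x.1 0 := (hTcT i).trans (hτTc.trans hx)
        have hmesh1 := (hTm (x.1 0) (hτTm.trans hx) i).1
        have hγw : γ₀ * ‖E4.spatial x.1 - ξ i (x.1 0)‖ ≤ ρ i (x.1 0) / 2 := by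
          have : γ₀ * ‖E4.spatial x.1 - ξ i (x.1 0)‖ ≤ γ₀ * R' (x.1 0) :=
            mul_le_mul_of_nonneg_left hi (zero_le_one.trans hγ₀1)
          have hRb : γ₀ * R' (x.1 0) * 1 ≤ γ₀ * R' (x.1 0) * γ₀ :=
            mul_le_mul_of_nonneg_left hγ₀1
              (mul_nonneg (zero_le_one.trans hγ₀1) (zero_le_one.trans (hR'1 _)))
          nlinarith [hR'1 (x.1 0)]
        exact (hrpw i x hxT hγw).trans (mul_le_mul_of_nonneg_left hi (zero_le_one.trans hγ₀1)))
    (fun x j hx ↦ hx j)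
    (by
      -- hcov
      intro i x hx hxr hxb
      refine exists_model_of_lab U Φ (hM i) (hV1 i) (ξ i) (v i) (hv1 i) hκ₀ (hvs i) (Λ i) (hfut i)
        (hvΛ i) (hAU i) (hcovA i) (hrad2 i) x ((hTcT i).trans hx) hxr ?_
      have hmesh1 := (hTm (x.1 0) (hTcm.trans hx) i).1
      have : γ₀ * rp i x ≤ γ₀ * (γ₀ * R' (x.1 0)) := mul_le_mul_of_nonneg_left hxb (zero_le_one.trans hγ₀1)
      nlinarith)
    (fun i y τ₁ hτ₁ hyS hy₁ hyR ↦ hhov i y τ₁ ((hττh i).trans hτ₁) ((hSi i).trans hyS) hy₁ hyR)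
    (by
      -- hmesh
      intro i t ht
      obtain ⟨-, h2, h3, h4, -⟩ := hTm t (hτTm.trans ht) i
      have hR'0' : 0 ≤ R' t := zero_le_one.trans (hR'1 t)
      have hβ0 : 0 ≤ ‖V i‖ := norm_nonneg _
      have hRb : γ₀ * R' t ≤ γ₀ ^ 2 * R' t := by
        have h := mul_le_mul_of_nonneg_left hγ₀1 (mul_nonneg (zero_le_one.trans hγ₀1) hR'0')
        nlinarith [h]
      have hβRb : ‖V i‖ * (γ₀ * R' t) ≤ (Lorentz.gamma (V i))⁻¹ * t / 2 := by nlinarith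
      have hS2 : Sa ≤ (Lorentz.gamma (V i))⁻¹ * t / 2 := by
        have h5 : 2 * |Sa| * Lorentz.gamma (V i) ≤ t := (hτS i).trans ht
        have hγ := hγV i
        have h6 : |Sa| ≤ (Lorentz.gamma (V i))⁻¹ * t / 2 := by
          rw [show (Lorentz.gamma (V i))⁻¹ * t / 2 = t / (2 * Lorentz.gamma (V i)) by
            field_simp, le_div_iff₀ (by positivity)]
          linarith
        exact (le_abs_self Sa).trans h6
      refine ⟨by linarith, ?_, by nlinarith⟩
      exact hRb.trans (h2.trans (hRm i (by linarith))))
    τ₁ hτ₁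
  -- ### pairwise disjointness
  have hinj : InjOn Φ {x : U | τ₀ < x.1 0} := by
    intro x hx y hy hxy
    have h := hembΦ.injective (a₁ := ⟨x, hx⟩) (a₂ := ⟨y, hy⟩) hxy
    exact congrArg Subtype.val h
  have hdisj := exists_pairwise_disjoint_truncLateRegion M ξ v hv1 V hV1 U Φ hinj A T ρ hAU
    (fun i x ↦ (hτ0T i).trans_lt (hAT i x)) hρt hhon hsep
  -- ### assembly
  have hflatemb' : IsOpenEmbedding (((Minkowski.backgroundOn U₀).lateRegion τ₁₀).restrict
      (Φ ∘ Opens.inclusion hU₀)) :=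
    isOpenEmbedding_restrict_late_mono (W := U₀) (by linarith) hflatemb
  refine exists_finalStateDecomposition_of_rechart 𝒟 M hM V hV1 U Φ hΦ O Pext hτ hO himO A hA hAU
    (fun i y ↦ ⟨(hτ0T i).trans_lt (hAT i y.1), hPextA i y⟩)
    (fun i ↦ isOpenEmbedding_rechart U Φ (hV1 i) (hAemb i) (hAU i) (hAT i) (hτ0T i) hembΦ)
    hconvR R hconvRi hdisj U₀ hU₀ ρexc hexc (fun x hx ↦ htube ⟨by linarith [hx.1], hx.2⟩) hflatdev
    hflatemb' (fun x hx j ↦ ?_) htransfer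
  -- flat late points lie outside every painted horizon
  have hxU : (x.1 : E4) ∈ (U₀ : Set E4) := x.2
  rw [hU₀eq] at hxU
  exact (hR'rp _ j).trans (hxU.2 j |>.trans_le (norm_sub_centre_le_paintedRadius (ξ j) (Λ j) x.1))

end Assembly

end Summit.FinalStateConjecture.FinalStateConjecture.Theorems

end
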